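import Summits.AtomisticToContinuum.BoseEinsteinCondensation.Theorems.BECVortexSheetPeierlsSpatialVillainLRO
import Summits.AtomisticToContinuum.BoseEinsteinCondensation.Theorems.BECVortexSheetPeierlsSliceMonotonicity

/-!
# Route BECVortexSheetPeierls — the engine ladder, glued:
# `HomogeneousVillainLRO → VillainCurrentLRO` (crux stmt-AtomisticToContinuum-13466)

The route's engine ladder "VillainCurrentLRO ⇐ SpatialVillainLRO → SliceMonotonicity →
VillainCurrentLRO" and "SpatialVillainLRO ⇐ HomogeneousVillainLRO" composed into theorems of the
tree, so that the crux `VillainCurrentLRO` (item 13466) and the support `SpatialVillainLRO`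
(item 13468) both close the moment `HomogeneousVillainLRO` (item 13470) is proved:

* `villainCurrentLRO_of_spatial_of_slice : SpatialVillainLRO → SliceMonotonicity → VillainCurrentLRO`
  — for `P : VillainCurrentModel 3 L M` with spatial stiffnesses in `[K, ΛK]`, its time-slice-`0`
  model `P₀ : VillainCurrentModel 3 L 1` (stiffness `b ↦ P.stiffness ((b.1.1, 0), b.2)`) has
  spatial stiffnesses in the same window, so `SpatialVillainLRO` bounds its block sum from below,
  and `SliceMonotonicity` (GKS-II in current variables, PROVED: `SliceMonotonicity_proof`) bounds
  it by the block sum of `P`;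
* `villainCurrentLRO_of_homogeneousVillainLRO : HomogeneousVillainLRO → VillainCurrentLRO` — with
  `spatialVillainLRO_of_homogeneousVillainLRO` (AHPS/Ginibre monotonicity + worm duality, PROVED).

Pure bookkeeping; the analytic content is `HomogeneousVillainLRO` (Fröhlich–Spencer 1982 /
Garban–Spencer 2022 for the Villain interaction on the 3-torus).
-/

noncomputable section

namespace Summit.AtomisticToContinuum.BoseEinsteinCondensation.Theorems

open scoped ENNReal BigOperators
open Literature.Probability.LatticeModels Literature.Probability.LatticeModels.JCurrent
open Summit.AtomisticToContinuum.BoseEinsteinCondensation.Theses.BECVortexSheetPeierls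

/-- **The engine ladder of route BECVortexSheetPeierls**: `SpatialVillainLRO` (the one-slice,
3-D statement) and `SliceMonotonicity` (GKS-II in current variables) imply the crux
`VillainCurrentLRO` with the same constants `K₀(Λ), c(Λ)`: the time-slice-`0` model of `P` has its
spatial stiffnesses in the same window `[K, ΛK]`, and its equal-time block sum is dominated by
that of `P`. [folklore] -/
theorem villainCurrentLRO_of_spatial_of_slice (hS : SpatialVillainLRO) (hM : SliceMonotonicity) :
    VillainCurrentLRO := by
  intro Λ hΛ
  obtain ⟨K₀, c, hc, H⟩ := hS Λ hΛ
  refine ⟨K₀, c, hc, ?_⟩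
  intro L M _ _ P K hK hb
  -- the time-slice-0 model and its stiffness window
  let P₀ : VillainCurrentModel 3 L 1 :=
    ⟨fun b => P.stiffness ((b.1.1, 0), b.2), fun _ => P.stiffness_pos _⟩
  have hb₀ : ∀ b : Bond 3 L 1, b.2 ≠ none → K ≤ P₀.stiffness b ∧ P₀.stiffness b ≤ Λ * K :=
    fun b h2 => hb ((b.1.1, 0), b.2) h2
  calc ENNReal.ofReal (c * (L : ℝ) ^ 6)
      ≤ ∑ x : TorusSite 3 L, ∑ y : TorusSite 3 L, P₀.twoPoint (x, 0) (y, 0) := H L P₀ K hK hb₀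
    _ ≤ ∑ x : TorusSite 3 L, ∑ y : TorusSite 3 L, P.twoPoint (x, 0) (y, 0) :=
        Finset.sum_le_sum fun x _ => Finset.sum_le_sum fun y _ => hM L M P x y

/-- **`HomogeneousVillainLRO → VillainCurrentLRO`**: the crux of route BECVortexSheetPeierls
(item stmt-AtomisticToContinuum-13466) reduced to its milestone `HomogeneousVillainLRO`
(item 13470) — compose `spatialVillainLRO_of_homogeneousVillainLRO` (Ginibre/AHPS monotonicity in
the bond stiffnesses + worm/rotor duality) with `villainCurrentLRO_of_spatial_of_slice` and the
proved `SliceMonotonicity_proof`. [folklore] -/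
theorem villainCurrentLRO_of_homogeneousVillainLRO (h : HomogeneousVillainLRO) : VillainCurrentLRO :=
  villainCurrentLRO_of_spatial_of_slice (spatialVillainLRO_of_homogeneousVillainLRO h)
    SliceMonotonicity_proof

end Summit.AtomisticToContinuum.BoseEinsteinCondensation.Theorems

end
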